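import Literature.AlgebraicGeometry.HodgeTheory.SemiregularityMapReal
import Literature.AlgebraicGeometry.Modules.ExtCohomologyComparison
import Literature.AlgebraicGeometry.Modules.InvertibleOfRankOne
import Literature.AlgebraicGeometry.Modules.Biduality
import Literature.Algebra.Homology.ExtBiproduct
import HarnessLib

/-!
# Rank-one finite locally free modules are `0`-semiregular: `Tr : Extⁱ(L, L) → Hⁱ(X, 𝒪_X)` is bijective

PROMOTED LITERATURE COPY (librarian protocol (b); cell `pub-hsemireg`, seat lit-4 g20) of the generic, conjecture-free helper
`Summits/HodgeConjecture/HodgeConjecture/Theorems/KleimanBFSeedsRankOneZeroSemiregular.lean` (route `KleimanBFSeeds`, crux K2) —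
namespace now `Literature.AlgebraicGeometry.HodgeTheory`, declaration NAMES AND PROOFS KEPT (§1–§3 below are that file's §1–§3 with
`import Mathlib` replaced by the five Literature imports it actually uses); the problem-side prose (seeds, K2 census) is dropped.
Reason for the copy: `Literature/` cannot import `Summits/`, and the rank-one case is the input of the line-bundle reading of the
first-order obstruction `ob_κ(L) = (id ⊗ κ) ∘ At(L)` (`HodgeTheory/KodairaSpencerObstructionTrace`: under `0`-semiregularity
`ob_κ(E) = 0 ↔ (Tr At(E)) · κ = 0`). THEOREMS ONLY: no definition, no named fact, no `instance`, no notation, no `sorry`.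

THE THEOREM. For a finite locally free `𝒪_X`-module `L` of (constant) rank one (`Motives.HasRank L 1`) on a scheme `X`, the sheaf
trace `tr : 𝓔nd(L) → 𝒪_X` is an ISOMORPHISM (biduality `Modules.isIso_toBidual` and the rank-one contraction
`Modules.isIso_contract_of_hasRank_one`); hence the trace on `Ext`, `Tr : Extⁱ(L, L) → Extⁱ(𝒪_X, 𝒪_X)` (`HodgeTheory.traceExt`),
which is Hartshorne's comparison `Extⁱ(L, L) ≅ Extⁱ(𝒪_X, 𝓔nd L)` (III.6.7, `Modules.extToExtUnitSheafHom_bijective`) followed by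
`tr`, is BIJECTIVE, and so is `Tr : Extⁱ(L, L) → Hⁱ(X, 𝒪_X)` (`traceToCohomology`, by III.6.3 (c), `Modules.extToCohomology_bijective`).
In degree `2` this is the component `σ_0` of the Buchweitz–Flenner semiregularity map: every rank-one `L` is `0`-SEMIREGULAR
(`IsZeroSemiregular`, `IsHigherSemiregular · 0`), hence `{0,1}`-semiregular, semiregular for the full real map (`IsSemiregularReal`),
and `I`-semiregular for every set of form degrees `I ∋ 0`.

## Sources, verbatim (held and read)

* [Artamkin1989DeformationOfSheaves] I. V. Artamkin, *On deformation of sheaves*, Math. USSR Izv. 32 (1989) 663–668, §1 Prop. 2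
  (p. 664): «1) There exist natural trace homomorphisms `tr : 𝓔nd 𝓕 → 𝒪_X`, `trⁱ : Extⁱ(𝓕, 𝓕) → Hⁱ(𝒪_X)`. 2) If `rk 𝓕 ≠ 0` and
  `char k ∤ rk 𝓕`, then there is a direct sum decomposition `𝓔nd 𝓕 = 𝒪_X ⊕ ad 𝓕` so that `tr(ad 𝓕) = 0` and the trace maps `trⁱ`
  are surjective.» — for `𝓕 = L` of rank one `ad L = 0`, `tr` is an isomorphism and the `trⁱ` are bijective (typed here,
  characteristic-free; the splitting for `rk ≥ 2` is NOT typed).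
* [BuchweitzFlenner2003] Compositio Math. 137 (arXiv:math/9912245), Introduction p. 4: «the work of Artamkin [Art] and Mukai [Muk]
  interprets `σ_0 : Ext²_X(𝓕, 𝓕) → H²(X, 𝒪_X)` as the map between obstruction spaces for the deformations of `𝓕` versus those of
  its determinant line bundle»; §1 («`k`-semiregular: the component `σ_k` […] is injective»), §4 (trace map), §5 (`I`-semiregular).
* [Hartshorne1977] II Ex. 5.1 (a)–(b), III Prop. 6.3 (c) (`Extⁱ(𝒪_X, 𝒢) ≅ Hⁱ(X, 𝒢)`), III Prop. 6.7 (`Extⁱ(𝓕 ⊗ 𝓛, 𝒢) ≅ Extⁱ(𝓕, 𝓛^∨ ⊗ 𝒢)`).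

Nothing here bears on HC; typed ≠ endorsed.
-/

noncomputable section

open CategoryTheory CategoryTheory.Abelian AlgebraicGeometry Opposite TopologicalSpace Limits

namespace Literature.AlgebraicGeometry.HodgeTheory

open Literature.AlgebraicGeometry.Modules Literature.AlgebraicGeometry.Motives
open Literature.Algebra.Homology

universe w u

/-! ### §1 The sheaf trace of a rank-one module is an isomorphism -/

section SheafTrace

variable {X : Scheme.{u}} {E : X.Modules}

/-- `𝓔nd(E) → 𝓗om(E, E^∨∨)` (post-composition with biduality) is an isomorphism for `E` finite locally free
(biduality `E ≅ E^∨∨`, Hartshorne II Ex. 5.1 (a), and functoriality of `𝓗om(E, –)`). [cite: Hartshorne1977, II Ex. 5.1 (a)] -/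
theorem isIso_endToBidual (hE : IsFiniteLocallyFree E) : IsIso (endToBidual (E := E)) := by
  haveI := isIso_toBidual E hE
  change IsIso ((sheafHomFunctor E).map (toBidual E (unitModule X)))
  infer_instance

/-- **The trace `tr : 𝓔nd(L) → 𝒪_X` of a rank-one finite locally free `L` is an isomorphism**: biduality followed by
the rank-one contraction `𝓗om(L, 𝓗om(L^∨, 𝒪_X)) ≅ 𝒪_X`. [cite: Hartshorne1977, II Ex. 5.1 (a)–(b)] [cite: Artamkin1989DeformationOfSheaves, §1 Prop. 2 (p. 664)] -/
theorem isIso_trace_of_hasRank_one (hE : IsFiniteLocallyFree E) (h₁ : HasRank E 1) : IsIso (trace hE) := by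
  haveI := isIso_endToBidual hE
  haveI := isIso_contract_of_hasRank_one hE (unitModule X) h₁
  exact IsIso.comp_isIso

end SheafTrace

/-! ### §2 The trace on `Ext` and to cohomology is bijective in rank one -/

section ExtTrace

variable {X : Scheme.{u}} [HasExt.{w} X.Modules] {E : X.Modules} (hE : IsFiniteLocallyFree E)

/-- `Tr = tr ∘ (Extⁱ(E, E) ≅ Extⁱ(𝒪_X, 𝓔nd E))`: the trace on `Ext` is Hartshorne's comparison map
`extToExtUnitSheafHom` (III.6.7) followed by post-composition with the sheaf trace. [cite: Hartshorne1977, III Prop. 6.7]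
[cite: BuchweitzFlenner2003, §4 (trace map)] -/
theorem traceExt_eq_extToExtUnitSheafHom_comp (i : ℕ) (x : Ext.{w} E E i) :
    traceExt hE i x = (extToExtUnitSheafHom hE E i x).comp (Ext.mk₀ (trace hE)) (add_zero i) := by
  rw [traceExt_apply, extToExtUnitSheafHom_apply]
  exact (Ext.comp_assoc_of_third_deg_zero _ _ _ _).symm

/-- **`Tr : Extⁱ(L, L) → Extⁱ(𝒪_X, 𝒪_X)` is bijective for `L` of rank one** (III.6.7 and `tr` an isomorphism).
[cite: Hartshorne1977, III Prop. 6.7] [cite: BuchweitzFlenner2003, §4 (trace map)] -/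
theorem traceExt_bijective_of_hasRank_one (h₁ : HasRank E 1) (i : ℕ) :
    Function.Bijective (traceExt hE i) := by
  haveI := isIso_trace_of_hasRank_one hE h₁
  have h := (Ext.comp_mk₀_hom_bijective (A := unitModule X) (n := i) (asIso (trace hE))).comp
    (extToExtUnitSheafHom_bijective hE E i)
  have hfun : (traceExt hE i : Ext.{w} E E i → Ext.{w} (unitModule X) (unitModule X) i) =
      (fun x : Ext.{w} (unitModule X) (sheafHom E E) i => x.comp (Ext.mk₀ (asIso (trace hE)).hom) (add_zero i)) ∘
        extToExtUnitSheafHom hE E i := by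
    funext x
    exact traceExt_eq_extToExtUnitSheafHom_comp hE i x
  rw [hfun]
  exact h

/-- **`Tr : Extⁱ(L, L) → Hⁱ(X, 𝒪_X)` is bijective for `L` of rank one** (add III.6.3 (c):
`Extⁱ(𝒪_X, 𝒪_X) ≅ Hⁱ(X, 𝒪_X)`). [cite: Hartshorne1977, III Prop. 6.3 (c) and Prop. 6.7] -/
theorem traceToCohomology_bijective_of_hasRank_one (h₁ : HasRank E 1) (i : ℕ) :
    Function.Bijective (traceToCohomology hE i) :=
  (extToCohomology_bijective (unitModule X) i).comp (traceExt_bijective_of_hasRank_one hE h₁ i)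

end ExtTrace

/-! ### §3 Rank one ⇒ `0`-semiregular ⇒ `I`-semiregular for every `I ∋ 0` -/

section Sigma

variable {S : Type u} [CommRing S] {X : Over (Spec (CommRingCat.of S))} [HasExt.{w} X.left.Modules]
  {L : X.left.Modules} (hL : IsFiniteLocallyFree L)

/-- **`σ_0 = Tr : Ext²(L, L) → H²(X, 𝒪_X)` is bijective for `L` of rank one.** [cite: BuchweitzFlenner2003, §1 (σ_0)] -/
theorem sigmaZero_bijective_of_hasRank_one (h₁ : HasRank L 1) : Function.Bijective (sigmaZero.{w} hL) :=
  traceToCohomology_bijective_of_hasRank_one hL h₁ 2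

/-- **A rank-one finite locally free module is `0`-semiregular** (`σ_0 = Tr` injective on `Ext²(L, L)`).
[cite: BuchweitzFlenner2003, §1 (k-semiregular)] -/
theorem isZeroSemiregular_of_hasRank_one (h₁ : HasRank L 1) : IsZeroSemiregular.{w} hL :=
  (sigmaZero_bijective_of_hasRank_one hL h₁).injective

/-- Rank one ⇒ `{0,1}`-semiregular (`(σ_0, σ_1)` injective). [cite: BuchweitzFlenner2003, §5 (I-semiregular)] -/
theorem isZeroOneSemiregular_of_hasRank_one (h₁ : HasRank L 1) : IsZeroOneSemiregular.{w} hL :=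
  (isZeroSemiregular_of_hasRank_one hL h₁).isZeroOneSemiregular hL

/-- Rank one ⇒ semiregular for the full real semiregularity map `(σ_q)_q`. [cite: BuchweitzFlenner2003, Def. 4.1] -/
theorem isSemiregularReal_of_hasRank_one (h₁ : HasRank L 1) : IsSemiregularReal.{w} hL :=
  (isZeroSemiregular_of_hasRank_one hL h₁).isSemiregularReal hL

/-- Rank one ⇒ `0`-semiregular in the uniform family `σ_q` of `SemiregularityHigherSigma` (`IsHigherSemiregular · 0`).
[cite: BuchweitzFlenner2003, §1 (k-semiregular)] -/
theorem isHigherSemiregular_zero_of_hasRank_one (h₁ : HasRank L 1) : IsHigherSemiregular.{w} hL 0 :=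
  (isHigherSemiregular_zero_iff hL).2 (isZeroSemiregular_of_hasRank_one hL h₁)

/-- **A rank-one finite locally free module is `I`-semiregular for every set of form degrees `I ∋ 0`.**
[cite: BuchweitzFlenner2003, §5 (I-semiregular)] -/
theorem isISemiregular_of_hasRank_one (h₁ : HasRank L 1) {I : Set ℕ} (hI : 0 ∈ I) : IsISemiregular.{w} hL I :=
  IsISemiregular.mono hL (Set.singleton_subset_iff.2 hI)
    ((isHigherSemiregular_iff_isISemiregular_singleton hL 0).1 (isHigherSemiregular_zero_of_hasRank_one hL h₁))

end Sigma

end Literature.AlgebraicGeometry.HodgeTheory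

end
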